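import Summits.ResolutionOfSingularities.ResolutionOfSingularities.Theses.CleanCovers
import Summits.ResolutionOfSingularities.ResolutionOfSingularities.Theses.FrobeniusClosing
import Summits.ResolutionOfSingularities.ResolutionOfSingularities.Theses.IndSmooth
import Summits.ResolutionOfSingularities.ResolutionOfSingularities.Theorems.CleanCoversCoverResolutionLocalPatching
import Summits.ResolutionOfSingularities.ResolutionOfSingularities.Theorems.CleanCoversCoverResolutionLocallyResolvable
import Summits.ResolutionOfSingularities.ResolutionOfSingularities.Theorems.CleanCoversCoverResolutionCalibration
import Summits.ResolutionOfSingularities.ResolutionOfSingularities.Theorems.CleanCoversCoverResolutionIffResPerfect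
import Summits.ResolutionOfSingularities.ResolutionOfSingularities.Theorems.CleanCoversCoverResolutionNormalReduction
import HarnessLib

/-!
# Line `strategy-split` v2.2 ("local resolution along `H` + the shared patching crux") —
# skeleton for the crux `CleanCovers.CoverResolution` (stmt-ResolutionOfSingularities-15104)

Line lead `prover-line-stmt-ResolutionOfSingularities-15104-c2-0` (continuation seat c2,
2026-08-17). RESHAPE of v2.1 (seat c1: stubs L⁰ `stub_boundaryLocalResolutionNormal` and T
`stub_twoModelPatchingPerfect` = Zariski's two-model patching of proper models over perfect
fields, composed through `stub_kedlayaLocalCover` / `stub_binaryPatchingOverField` /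
`stub_coverInductionOverField`, all three landed). v2.2 keeps the composition idea — a LOCAL half
along the hyperplane at infinity and a PATCHING half — and keeps the local stub L⁰ verbatim (the
cleaning engine's typed output), but replaces the free-floating patching stub T by the statement
the programme already carries as an ITEM: the sibling crux

* `FrobeniusClosing.PatchingRelPerfect` (stmt-ResolutionOfSingularities-16161; one term shared by
  eight routes; reduced in the tree by its own line `closed-point-slice` to a dimension-4 punctual
  atom + a dimension-`≥ 5` residual + printed Cossart–Piltant / CJS inputs,
  `Theorems.patchingRelPerfect_of_printed_of_atomDimFour_of_dimGeFive`): for every prime `p`,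
  relative local uniformization over perfect fields of characteristic `p` implies resolution of
  every reduced separated scheme of finite type over every perfect field of characteristic `p`.

Composition (all links LANDED): L⁰ ⟹ L (`Theorems.boundaryLocalResolution_of_normal`: normalise,
the normalisation of a Kedlaya cover is a Kedlaya cover) ⟹ LocRes_perfect
(`Theorems.locallyResolvable_perfect_of_boundaryLocalResolution`: affine neighbourhood ↪ projective
closure, Kedlaya's theorem `Kedlaya2004_finite_etale_off_hyperplane_holds` PROVED in the tree, pull
back) ⟹ relative local uniformization over perfect fields = the item `IndSmooth.LurelPerfect`
verbatim (`Theorems.relLUPerfect_of_locallyResolvablePerfect`: affine models and centres of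
valuations) ⟹[stub PRP] resolution over perfect fields ⟹ the crux
(`Theorems.coverResolution_iff_resPerfect`, through the PROVED route item `KedlayaReduction`).

Why this reshape: (i) both v2.1 stubs were open problems; T was a statement no item carries
(only sibling STUBS share it), whereas PRP is an existing crux with a live reduction, so the
residual of THIS crux is now {L⁰ (route-owned: the engine), stmt-16161 (shared)} and nothing
else; (ii) PRP is the weakest patching statement that suffices here — with L in hand one has LU
over ALL perfect fields of characteristic `p` at once, exactly PRP's antecedent; the per-field
`PatchingPerfect` (stmt-16089) and T are stronger asks; (iii) the floor of the split is an
equivalence of items, `CoverResolution ↔ IndSmooth.LurelPerfect ∧ FrobeniusClosing.PatchingRelPerfect`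
(certificate `Theorems/CleanCoversCoverResolutionIffLurelAndPatchingRel.lean`), and
`CoverResolution ↔ L⁰ ∧ PatchingRelPerfect` likewise — nothing is lost.

Sorries only in `stub_*` (exactly two: L⁰ and PRP); `CoverResolution_of` concludes
`Summit.ResolutionOfSingularities.ResolutionOfSingularities.Theses.CleanCovers.CoverResolution` by name.
The v2.1 form `CR ↔ L ∧ T` stays landed (`Theorems/CleanCoversCoverResolutionLocalPatching.lean`,
p164058) with its graded version and `d = 4` frontier (`…Graded.lean`, p167585).
-/

set_option linter.dupNamespace false

namespace Summit.ResolutionOfSingularities.ResolutionOfSingularities.Cruxes.CoverResolution.StrategySplit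

open CategoryTheory AlgebraicGeometry TopologicalSpace
open Literature.AlgebraicGeometry.Resolution
open Summit.ResolutionOfSingularities.ResolutionOfSingularities.Theses
open Summit.ResolutionOfSingularities.ResolutionOfSingularities.Theses.CleanCovers

/-- STUB L⁰ `boundaryLocalResolutionNormal` (OPEN; summit-implied; the engine's typed output): for
every NORMAL Kedlaya cover `f : X → ℙⁿ_k` (all local rings integrally closed) and every point `h`
off the chart `D₊(xₙ)` there is an open `B ∋ h` of `ℙⁿ_k` with `f⁻¹(B)` admitting a resolution of
singularities. (The route's engine — base-only cleaning of the wild ramification, then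
"clean + (NpS) ⇒ log-regular normalisation", then Nizioł/Kato locally — works with the normal
cover.) It implies the item `IndSmooth.LurelPerfect` (`Theorems.lurelPerfect_of_boundaryLocalResolutionNormal`,
certificate file) and is implied by the crux (restriction of a resolution). -/
theorem stub_boundaryLocalResolutionNormal : ∀ p : ℕ, p.Prime → ∀ (k : Type) [Field k] [CharP k p] [PerfectField k] (n : ℕ) (X : AlgebraicGeometry.Scheme.{0}) (f : X ⟶ (Literature.AlgebraicGeometry.Motives.projectiveSpace n k).left), AlgebraicGeometry.IsIntegral X → AlgebraicGeometry.IsFinite f → Function.Surjective f.base → (letI := MvPolynomial.gradedAlgebra (σ := Fin (n + 1)) (R := k); AlgebraicGeometry.Etale (f ∣_ (AlgebraicGeometry.Proj.basicOpen (MvPolynomial.homogeneousSubmodule (Fin (n + 1)) k) (MvPolynomial.X (Fin.last n))))) → (∀ x : X, IsIntegrallyClosed (X.presheaf.stalk x)) → ∀ h : (Literature.AlgebraicGeometry.Motives.projectiveSpace n k).left, (letI := MvPolynomial.gradedAlgebra (σ := Fin (n + 1)) (R := k); h ∉ AlgebraicGeometry.Proj.basicOpen (MvPolynomial.homogeneousSubmodule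 (Fin (n + 1)) k) (MvPolynomial.X (Fin.last n))) → ∃ B : (Literature.AlgebraicGeometry.Motives.projectiveSpace n k).left.Opens, h ∈ B ∧ Literature.AlgebraicGeometry.Resolution.Scheme.HasResolution ((f ⁻¹ᵁ B : X.Opens) : AlgebraicGeometry.Scheme.{0}) := by
  sorry

/-- STUB PRP `patchingRelPerfect` (OPEN in dimension `≥ 4`; summit-implied) — VERBATIM the sibling
crux `FrobeniusClosing.PatchingRelPerfect` (stmt-ResolutionOfSingularities-16161): for every prime
`p`, relative local uniformization for all finitely generated `K/k` with `k` perfect of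
characteristic `p` implies that every reduced separated scheme of finite type over every perfect
field of characteristic `p` has a resolution. Closed by `PatchingRelPerfect_holds` the day that item
closes; its own line has reduced it to a dimension-4 punctual atom + a dimension-`≥ 5` residual +
printed inputs (`Theorems.patchingRelPerfect_of_printed_of_atomDimFour_of_dimGeFive`). -/
theorem stub_patchingRelPerfect :
    Summit.ResolutionOfSingularities.ResolutionOfSingularities.Theses.FrobeniusClosing.PatchingRelPerfect := by
  sorry

/-- L `boundaryLocalResolution` (DERIVED): local resolution along the hyperplane at infinity for ALL
Kedlaya covers, from the normal case L⁰ (`Theorems.boundaryLocalResolution_of_normal`, p164727).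
[folklore] -/
theorem boundaryLocalResolution : ∀ p : ℕ, p.Prime → ∀ (k : Type) [Field k] [CharP k p] [PerfectField k] (n : ℕ) (X : AlgebraicGeometry.Scheme.{0}) (f : X ⟶ (Literature.AlgebraicGeometry.Motives.projectiveSpace n k).left), AlgebraicGeometry.IsIntegral X → AlgebraicGeometry.IsFinite f → Function.Surjective f.base → (letI := MvPolynomial.gradedAlgebra (σ := Fin (n + 1)) (R := k); AlgebraicGeometry.Etale (f ∣_ (AlgebraicGeometry.Proj.basicOpen (MvPolynomial.homogeneousSubmodule (Fin (n + 1)) k) (MvPolynomial.X (Fin.last n))))) → ∀ h : (Literature.AlgebraicGeometry.Motives.projectiveSpace n k).left, (letI := MvPolynomial.gradedAlgebra (σ := Fin (n + 1)) (R := k); h ∉ AlgebraicGeometry.Proj.basicOpen (MvPolynomial.homogeneousSubmodule (Fin (n + 1)) k) (MvPolynomial.X (Fin.last n))) → ∃ B : (Literature.AlgebraicGeometry.Motives.projectiveSpace n k).left.Opens, h ∈ B ∧ Literature.AlgebraicGeometry.Resolution.Scheme.HasResolution ((f ⁻¹ᵁ B : X.Opens) : AlgebraicGeometry.Scheme.{0})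 :=
  Summit.ResolutionOfSingularities.ResolutionOfSingularities.Theorems.boundaryLocalResolution_of_normal
    stub_boundaryLocalResolutionNormal

/-- LurelPerfect (DERIVED): relative local uniformization over perfect fields — verbatim the item
`IndSmooth.LurelPerfect` (stmt-16086) — from L: localise by Kedlaya's theorem
(`Theorems.locallyResolvable_perfect_of_boundaryLocalResolution`, p167336) and uniformize the
centre of a valuation on a local resolution of an affine model
(`Theorems.relLUPerfect_of_locallyResolvablePerfect`, p168101). [cite: Kedlaya2004, Thm. 1] -/
theorem lurelPerfect : Summit.ResolutionOfSingularities.ResolutionOfSingularities.Theses.IndSmooth.LurelPerfect :=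
  Summit.ResolutionOfSingularities.ResolutionOfSingularities.Theorems.relLUPerfect_of_locallyResolvablePerfect
    (Summit.ResolutionOfSingularities.ResolutionOfSingularities.Theorems.locallyResolvable_perfect_of_boundaryLocalResolution
      boundaryLocalResolution)

/-- COMPOSITION: LurelPerfect is, prime by prime, the antecedent of PRP, whose consequent —
resolution of reduced separated schemes of finite type over perfect fields of characteristic `p`
for every prime `p` — is the crux (`Theorems.coverResolution_iff_resPerfect`, p164448, through the
proved route item `KedlayaReduction`). [folklore] -/
theorem CoverResolution_of :
    Summit.ResolutionOfSingularities.ResolutionOfSingularities.Theses.CleanCovers.CoverResolution :=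
  Summit.ResolutionOfSingularities.ResolutionOfSingularities.Theorems.coverResolution_iff_resPerfect.mpr
    fun p hp => stub_patchingRelPerfect p hp (fun k K _ _ _ _ _ => lurelPerfect p hp k K)

end Summit.ResolutionOfSingularities.ResolutionOfSingularities.Cruxes.CoverResolution.StrategySplit
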